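import Summits.Ventures.HodgeRepro2.T5CartanWeylInverse
import Summits.Ventures.HodgeRepro2.T5HeckeFiniteOrbitPullback
import Summits.Ventures.HodgeRepro2.T5CartanDominant
import Summits.Ventures.HodgeRepro2.T5CartanUniformiser

/-!
# T5UnitaryGroupForm — the unitary group of a hermitian form, its Hecke algebra at an inert place
modulo the printed Cartan decomposition

Blind cell pub-hodge-repro2, seat p8, Tier-5 kernel support (CHECK-N3 §19.1 row 5: the INERT places).

* `formUnitaryGroup J : Subgroup (GL ι E)` — `U(J) = {g | gᴴ J g = J}` for a matrix `J` over a commutative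
  ring `E` with an involution (`StarRing E`; for the record `E = E_v`, the star = the Galois conjugation of
  `E_v/F_v`, `J` the Gram matrix of the hermitian space in a basis of a self-dual lattice). No hermitian
  condition on `J` is needed for the group structure.
* `permUnit_mem_formUnitaryGroup`: the permutation matrix `P_σ` lies in `U(J)` when `J (σ i) (σ j) = J i j`
  (Mathlib's `conjTranspose_permMatrix`); for `σ = Fin.rev` and `J = antidiag(1, …, u, …, 1)` this is the
  element of `N_K(A)` acting as `−1` on the maximal split torus.
* `permUnit_mul_diagonalUnit_zpow_mul_inv`: `P_σ · diag(ϖ^{m}) · P_σ⁻¹ = diag(ϖ^{m})⁻¹` for `m ∘ σ = −m`.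
* MAIN (`heckeAlgebra_mul_comm_of_cartan`, `finrank_invariants_eq_one_of_cartan`,
  `apply_heckeSMul_doubleCosetOp_self_of_cartan`, `ncard_orbit_inv_eq_of_cartan`): for `R` a DVR with
  finite residue field, `E = Frac R`, `K := GL_n(R)`, `U := U(J)`, `K_U := K ∩ U`, and a unit `ϖ`, IF the
  CARTAN DECOMPOSITION `U = ⋃_{m ∘ σ = −m} K_U · diag(ϖ^{m}) · K_U` holds (hypothesis `hcartan`) THEN
  `H(U, K_U)` is commutative (all `K_U g K_U / K_U` finite by T5HeckeFiniteOrbitPullback), the spherical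
  line of an irreducible `K_U`-finite representation is one-dimensional, every `T_g` is self-adjoint for a
  `U`-invariant hermitian form, and `#(K_U g⁻¹ K_U / K_U) = #(K_U g K_U / K_U)`. The `Fin n` / `Fin.rev`
  specialisation `heckeAlgebra_mul_comm_of_cartan_rev` is the printed shape
  `diag(ϖ^{m_1}, …, ϖ^{m_r}, 1, ϖ^{-m_r}, …, ϖ^{-m_1})`.

WHAT STAYS PROSE: the Cartan decomposition of `U(J)` with respect to `K_U` (the printed Bruhat–Tits /
Tits statement for the unramified unitary group and its hyperspecial `K`) enters ONLY as the hypothesis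
`hcartan`; the identification of the record's `U(V_v)`, `K_v`, `𝒪_v`, `ϖ_v` with `formUnitaryGroup J`,
`K_U`, `R`, `ϖ` is a reading; the Satake isomorphism and every printed theorem. The `−1` of the relative Weyl
group and the finiteness of the double cosets are no longer prose.
-/

namespace Summit.Ventures.HodgeRepro2.T5UnitaryGroupForm

open Summit.Ventures.HodgeRepro2 Matrix

section Group

variable {E : Type*} [CommRing E] {ι : Type*} [Fintype ι] [DecidableEq ι]

section StarRing

variable [StarRing E]

/-- The unitary group of the form with Gram matrix `J`: `U(J) = {g ∈ GL ι E | gᴴ J g = J}`, with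
`gᴴ = star gᵀ` Mathlib's `conjTranspose` for the involution `star` of `E`. -/
def formUnitaryGroup (J : Matrix ι ι E) : Subgroup (GL ι E) where
  carrier := {g | (g : Matrix ι ι E)ᴴ * J * (g : Matrix ι ι E) = J}
  one_mem' := by simp
  mul_mem' := by
    intro a b ha hb
    simp only [Set.mem_setOf_eq] at ha hb ⊢
    rw [Units.val_mul, conjTranspose_mul]
    calc (b : Matrix ι ι E)ᴴ * (a : Matrix ι ι E)ᴴ * J * ((a : Matrix ι ι E) * b)
        = (b : Matrix ι ι E)ᴴ * ((a : Matrix ι ι E)ᴴ * J * a) * b := by simp only [Matrix.mul_assoc]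
      _ = J := by rw [ha, hb]
  inv_mem' := by
    intro a ha
    simp only [Set.mem_setOf_eq] at ha ⊢
    have h1 : ((a⁻¹ : GL ι E) : Matrix ι ι E)ᴴ * (a : Matrix ι ι E)ᴴ = 1 := by
      rw [← conjTranspose_mul, Units.mul_inv, conjTranspose_one]
    have h2 : (a : Matrix ι ι E) * ((a⁻¹ : GL ι E) : Matrix ι ι E) = 1 := Units.mul_inv a
    calc ((a⁻¹ : GL ι E) : Matrix ι ι E)ᴴ * J * ((a⁻¹ : GL ι E) : Matrix ι ι E)
        = ((a⁻¹ : GL ι E) : Matrix ι ι E)ᴴ * ((a : Matrix ι ι E)ᴴ * J * a) *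
            ((a⁻¹ : GL ι E) : Matrix ι ι E) := by rw [ha]
      _ = (((a⁻¹ : GL ι E) : Matrix ι ι E)ᴴ * (a : Matrix ι ι E)ᴴ) * J *
            ((a : Matrix ι ι E) * ((a⁻¹ : GL ι E) : Matrix ι ι E)) := by simp only [Matrix.mul_assoc]
      _ = J := by rw [h1, h2, Matrix.one_mul, Matrix.mul_one]

/-- Membership in `U(J)`: `gᴴ J g = J`. -/
theorem mem_formUnitaryGroup_iff {J : Matrix ι ι E} {g : GL ι E} :
    g ∈ formUnitaryGroup J ↔ (g : Matrix ι ι E)ᴴ * J * (g : Matrix ι ι E) = J := Iff.rfl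

omit [StarRing E] in
/-- Conjugating a matrix by a permutation matrix permutes rows and columns:
`P_σ · M · P_σ⁻¹ = M.submatrix σ σ`, i.e. `(P_σ M P_σ⁻¹) i j = M (σ i) (σ j)` (T5CartanDominant's diagonal case
for an arbitrary matrix). -/
theorem permMatrix_mul_mul_permMatrix_inv (σ : Equiv.Perm ι) (M : Matrix ι ι E) :
    Equiv.Perm.permMatrix E σ * M * Equiv.Perm.permMatrix E σ⁻¹ = M.submatrix σ σ := by
  rw [Equiv.Perm.permMatrix, Equiv.Perm.permMatrix, PEquiv.toMatrix_toPEquiv_mul,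
    PEquiv.mul_toMatrix_toPEquiv, submatrix_submatrix]
  rfl

/-- The permutation matrix `P_σ` lies in `U(J)` as soon as `J (σ i) (σ j) = J i j` for all `i, j`
(`P_σᴴ = P_{σ⁻¹}` since the entries are `0, 1`). For `σ = Fin.rev` and `J = antidiag(1, …, u, …, 1)` this is
the Weyl element acting as `−1` on the maximal split torus of the quasi-split unitary group. -/
theorem permUnit_mem_formUnitaryGroup (J : Matrix ι ι E) (σ : Equiv.Perm ι)
    (hJ : ∀ i j, J (σ i) (σ j) = J i j) :
    T5CartanDominant.permUnit E σ ∈ formUnitaryGroup J := by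
  rw [mem_formUnitaryGroup_iff, T5CartanDominant.coe_permUnit, conjTranspose_permMatrix]
  have h := permMatrix_mul_mul_permMatrix_inv σ⁻¹ J
  rw [inv_inv] at h
  rw [h]
  ext i j
  rw [submatrix_apply]
  have := hJ (σ⁻¹ i) (σ⁻¹ j)
  simp only [Equiv.Perm.coe_inv, Equiv.apply_symm_apply] at this
  exact this.symm

/-- A diagonal unit matrix `diag(d)` lies in `U(J)` as soon as `star (d i) * d j = 1` whenever `J i j ≠ 0`
(entrywise `(diag(d)ᴴ J diag(d)) i j = star (d i) * J i j * d j`). -/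
theorem diagonalUnit_mem_formUnitaryGroup (J : Matrix ι ι E) (d : ι → Eˣ)
    (hd : ∀ i j, J i j ≠ 0 → star (d i : E) * d j = 1) :
    T5CartanUniformiser.diagonalUnit d ∈ formUnitaryGroup J := by
  rw [mem_formUnitaryGroup_iff, T5CartanUniformiser.coe_diagonalUnit, diagonal_conjTranspose]
  ext i j
  rw [mul_diagonal, diagonal_mul, Pi.star_apply]
  by_cases h : J i j = 0
  · rw [h, mul_zero, zero_mul]
  · calc star (d i : E) * J i j * d j = (star (d i : E) * d j) * J i j := by ring
      _ = J i j := by rw [hd i j h, one_mul]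

end StarRing

/-- The inverse of a diagonal unit matrix is the diagonal of the inverses. -/
theorem diagonalUnit_inv (u : ι → Eˣ) :
    (T5CartanUniformiser.diagonalUnit u)⁻¹ = T5CartanUniformiser.diagonalUnit (fun i => (u i)⁻¹) :=
  Units.ext rfl

/-- `P_σ · diag(u) · P_σ⁻¹ = diag(u ∘ σ)` in `GL ι E` (T5CartanDominant on the matrices). -/
theorem permUnit_mul_diagonalUnit_mul_permUnit_inv (σ : Equiv.Perm ι) (u : ι → Eˣ) :
    T5CartanDominant.permUnit E σ * T5CartanUniformiser.diagonalUnit u *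
        (T5CartanDominant.permUnit E σ)⁻¹ =
      T5CartanUniformiser.diagonalUnit (u ∘ σ) := by
  apply Units.ext
  rw [Units.val_mul, Units.val_mul, T5CartanDominant.coe_permUnit, T5CartanDominant.coe_permUnit_inv,
    T5CartanUniformiser.coe_diagonalUnit, T5CartanUniformiser.coe_diagonalUnit,
    T5CartanDominant.permMatrix_mul_diagonal_mul_permMatrix_inv]
  rfl

/-- THE `−1` OF THE WEYL GROUP ON THE TORUS: for `m ∘ σ = −m` (e.g. `σ = Fin.rev`,
`m = (m_1, …, m_r, 0, −m_r, …, −m_1)`), `P_σ · diag(ϖ^{m}) · P_σ⁻¹ = diag(ϖ^{m})⁻¹`. -/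
theorem permUnit_mul_diagonalUnit_zpow_mul_inv (σ : Equiv.Perm ι) (ϖ : Eˣ) (m : ι → ℤ)
    (hm : ∀ i, m (σ i) = - m i) :
    T5CartanDominant.permUnit E σ * T5CartanUniformiser.diagonalUnit (fun i => ϖ ^ m i) *
        (T5CartanDominant.permUnit E σ)⁻¹ =
      (T5CartanUniformiser.diagonalUnit (fun i => ϖ ^ m i))⁻¹ := by
  rw [permUnit_mul_diagonalUnit_mul_permUnit_inv, diagonalUnit_inv]
  congr 1
  funext i
  simp only [Function.comp, hm, _root_.zpow_neg]

end Group

section Local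

variable {R : Type*} [CommRing R] {E : Type*} [Field E] [StarRing E] [Algebra R E]
  {ι : Type*} [Fintype ι] [DecidableEq ι]

/-- The torus elements `diag(ϖ^{m})` with `m ∘ σ = −m` lie in `U(J)` when `ϖ` is fixed by the involution
and `J` is supported on the graph of `σ` (`J i j ≠ 0 → j = σ i`, e.g. `J = antidiag(1, …, u, …, 1)` with
`σ = Fin.rev`): `star(ϖ^{m i}) · ϖ^{m (σ i)} = ϖ^{m i − m i} = 1`. So `torusSet` is the set it should be. -/
theorem diagonalUnit_zpow_mem_formUnitaryGroup (J : Matrix ι ι E) (σ : Equiv.Perm ι) (ϖ : Eˣ)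
    (hϖ : star (ϖ : E) = ϖ) (hJσ : ∀ i j, J i j ≠ 0 → j = σ i) (m : ι → ℤ)
    (hm : ∀ i, m (σ i) = - m i) :
    T5CartanUniformiser.diagonalUnit (fun i => ϖ ^ m i) ∈ formUnitaryGroup J := by
  apply diagonalUnit_mem_formUnitaryGroup
  intro i j hij
  obtain rfl := hJσ i j hij
  rw [Units.val_zpow_eq_zpow_val, Units.val_zpow_eq_zpow_val, star_zpow₀, hϖ, hm,
    ← zpow_add₀ ϖ.ne_zero, add_neg_cancel, zpow_zero]

omit [StarRing E] in
/-- A permutation matrix is integral: `P_σ ∈ GL_n(R) = (GeneralLinearGroup.map (algebraMap R E)).range`. -/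
theorem permUnit_mem_range (σ : Equiv.Perm ι) :
    T5CartanDominant.permUnit E σ ∈ (Matrix.GeneralLinearGroup.map (algebraMap R E)).range :=
  ⟨T5CartanDominant.permUnit R σ, T5CartanDominant.map_permUnit _ _⟩

/-- The Weyl element `P_σ` as an element of `U(J)`. -/
def weylElement (J : Matrix ι ι E) (σ : Equiv.Perm ι) (hJ : ∀ i j, J (σ i) (σ j) = J i j) :
    formUnitaryGroup J :=
  ⟨T5CartanDominant.permUnit E σ, permUnit_mem_formUnitaryGroup J σ hJ⟩

/-- The Weyl element lies in the hyperspecial subgroup `K_U = GL_n(R) ∩ U(J)`. -/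
theorem weylElement_mem_subgroupOf (J : Matrix ι ι E) (σ : Equiv.Perm ι)
    (hJ : ∀ i j, J (σ i) (σ j) = J i j) :
    weylElement J σ hJ ∈
      (Matrix.GeneralLinearGroup.map (algebraMap R E)).range.subgroupOf (formUnitaryGroup J) :=
  Subgroup.mem_subgroupOf.2 (permUnit_mem_range σ)

/-- The torus representatives inside `U(J)`: the elements whose matrix is `diag(ϖ^{m})` with `m ∘ σ = −m`. -/
def torusSet (J : Matrix ι ι E) (σ : Equiv.Perm ι) (ϖ : Eˣ) : Set (formUnitaryGroup J) :=
  {a | ∃ m : ι → ℤ, (∀ i, m (σ i) = - m i) ∧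
    (a : GL ι E) = T5CartanUniformiser.diagonalUnit (fun i => ϖ ^ m i)}

/-- `1 ∈ torusSet` (the exponent `m = 0`): the set of torus representatives is non-empty. -/
theorem one_mem_torusSet (J : Matrix ι ι E) (σ : Equiv.Perm ι) (ϖ : Eˣ) :
    (1 : formUnitaryGroup J) ∈ torusSet J σ ϖ := by
  refine ⟨0, fun _ => by simp, ?_⟩
  rw [Subgroup.coe_one]
  apply Units.ext
  rw [T5CartanUniformiser.coe_diagonalUnit, Units.val_one]
  simp only [Pi.zero_apply, zpow_zero, Units.val_one, diagonal_one]

/-- `w · a · w⁻¹ = a⁻¹` inside `U(J)` for the Weyl element `w = P_σ` and every torus representative `a`. -/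
theorem weylElement_mul_mul_inv (J : Matrix ι ι E) (σ : Equiv.Perm ι)
    (hJ : ∀ i j, J (σ i) (σ j) = J i j) (ϖ : Eˣ) :
    ∀ a ∈ torusSet J σ ϖ, weylElement J σ hJ * a * (weylElement J σ hJ)⁻¹ = a⁻¹ := by
  rintro a ⟨m, hm, ha⟩
  apply Subtype.ext
  rw [Subgroup.coe_mul, Subgroup.coe_mul, Subgroup.coe_inv, Subgroup.coe_inv, ha]
  exact permUnit_mul_diagonalUnit_zpow_mul_inv σ ϖ m hm

/-- The Cartan decomposition in the printed shape (`hcartan`: every `g ∈ U(J)` is `k₁ · diag(ϖ^{m}) · k₂`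
with `k₁, k₂ ∈ K_U` and `m ∘ σ = −m`) rewritten as `U(J) = K_U · torusSet · K_U`
(the form consumed by T5CartanWeylInverse). -/
theorem cartan_torusSet (J : Matrix ι ι E) (σ : Equiv.Perm ι) (ϖ : Eˣ)
    (hcartan : ∀ g : formUnitaryGroup J,
      ∃ k₁ ∈ (Matrix.GeneralLinearGroup.map (algebraMap R E)).range.subgroupOf (formUnitaryGroup J),
      ∃ k₂ ∈ (Matrix.GeneralLinearGroup.map (algebraMap R E)).range.subgroupOf (formUnitaryGroup J),
      ∃ m : ι → ℤ, (∀ i, m (σ i) = - m i) ∧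
        (g : GL ι E) = k₁ * T5CartanUniformiser.diagonalUnit (fun i => ϖ ^ m i) * k₂) :
    ∀ g : formUnitaryGroup J,
      ∃ k₁ ∈ (Matrix.GeneralLinearGroup.map (algebraMap R E)).range.subgroupOf (formUnitaryGroup J),
      ∃ a ∈ torusSet J σ ϖ,
      ∃ k₂ ∈ (Matrix.GeneralLinearGroup.map (algebraMap R E)).range.subgroupOf (formUnitaryGroup J),
        g = k₁ * a * k₂ := by
  intro g
  obtain ⟨k₁, hk₁, k₂, hk₂, m, hm, hg⟩ := hcartan g
  refine ⟨k₁, hk₁, k₁⁻¹ * g * k₂⁻¹, ⟨m, hm, ?_⟩, k₂, hk₂, by group⟩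
  rw [Subgroup.coe_mul, Subgroup.coe_mul, Subgroup.coe_inv, Subgroup.coe_inv, hg]
  group

/-- `g⁻¹ ∈ K_U g K_U` for every `g ∈ U(J)`, under the Cartan decomposition (orbit form). -/
theorem inv_mem_orbit_of_cartan (J : Matrix ι ι E) (σ : Equiv.Perm ι)
    (hJ : ∀ i j, J (σ i) (σ j) = J i j) (ϖ : Eˣ)
    (hcartan : ∀ g : formUnitaryGroup J,
      ∃ k₁ ∈ (Matrix.GeneralLinearGroup.map (algebraMap R E)).range.subgroupOf (formUnitaryGroup J),
      ∃ k₂ ∈ (Matrix.GeneralLinearGroup.map (algebraMap R E)).range.subgroupOf (formUnitaryGroup J),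
      ∃ m : ι → ℤ, (∀ i, m (σ i) = - m i) ∧
        (g : GL ι E) = k₁ * T5CartanUniformiser.diagonalUnit (fun i => ϖ ^ m i) * k₂)
    (g : formUnitaryGroup J) :
    (↑g⁻¹ : formUnitaryGroup J ⧸
        (Matrix.GeneralLinearGroup.map (algebraMap R E)).range.subgroupOf (formUnitaryGroup J)) ∈
      MulAction.orbit
        ((Matrix.GeneralLinearGroup.map (algebraMap R E)).range.subgroupOf (formUnitaryGroup J)) (↑g) :=
  T5CartanWeylInverse.inv_mem_orbit_of_weyl (cartan_torusSet J σ ϖ hcartan)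
    (weylElement_mem_subgroupOf J σ hJ) (weylElement_mul_mul_inv J σ hJ ϖ) g

/-- The counting form of unimodularity for `U(J)`, `K_U`: `#(K_U g⁻¹ K_U / K_U) = #(K_U g K_U / K_U)`. -/
theorem ncard_orbit_inv_eq_of_cartan (J : Matrix ι ι E) (σ : Equiv.Perm ι)
    (hJ : ∀ i j, J (σ i) (σ j) = J i j) (ϖ : Eˣ)
    (hcartan : ∀ g : formUnitaryGroup J,
      ∃ k₁ ∈ (Matrix.GeneralLinearGroup.map (algebraMap R E)).range.subgroupOf (formUnitaryGroup J),
      ∃ k₂ ∈ (Matrix.GeneralLinearGroup.map (algebraMap R E)).range.subgroupOf (formUnitaryGroup J),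
      ∃ m : ι → ℤ, (∀ i, m (σ i) = - m i) ∧
        (g : GL ι E) = k₁ * T5CartanUniformiser.diagonalUnit (fun i => ϖ ^ m i) * k₂)
    (g : formUnitaryGroup J) :
    (MulAction.orbit
        ((Matrix.GeneralLinearGroup.map (algebraMap R E)).range.subgroupOf (formUnitaryGroup J))
        (↑g⁻¹ : formUnitaryGroup J ⧸
          (Matrix.GeneralLinearGroup.map (algebraMap R E)).range.subgroupOf (formUnitaryGroup J))).ncard =
      (MulAction.orbit
        ((Matrix.GeneralLinearGroup.map (algebraMap R E)).range.subgroupOf (formUnitaryGroup J))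
        (↑g : formUnitaryGroup J ⧸
          (Matrix.GeneralLinearGroup.map (algebraMap R E)).range.subgroupOf (formUnitaryGroup J))).ncard :=
  T5CartanWeylInverse.ncard_orbit_inv_eq_of_cartan (cartan_torusSet J σ ϖ hcartan)
    (T5CartanWeylInverse.exists_inv_eq_mul_mul_of_weyl (weylElement_mem_subgroupOf J σ hJ)
      (weylElement_mul_mul_inv J σ hJ ϖ)) g

variable [IsDomain R] [IsFractionRing R E] [IsDiscreteValuationRing R]
  [Finite (IsLocalRing.ResidueField R)]

/-- `H(U(J), K_U)` IS COMMUTATIVE — `R` a DVR with finite residue field, `E = Frac R`, modulo the Cartan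
decomposition `hcartan` (the printed Bruhat–Tits statement at an inert place): Gelfand's trick in its
inversion form with the Weyl element `P_σ`, the finiteness of the double cosets from T5HeckeFiniteOrbitPullback. -/
theorem heckeAlgebra_mul_comm_of_cartan (J : Matrix ι ι E) (σ : Equiv.Perm ι)
    (hJ : ∀ i j, J (σ i) (σ j) = J i j) (ϖ : Eˣ)
    (hcartan : ∀ g : formUnitaryGroup J,
      ∃ k₁ ∈ (Matrix.GeneralLinearGroup.map (algebraMap R E)).range.subgroupOf (formUnitaryGroup J),
      ∃ k₂ ∈ (Matrix.GeneralLinearGroup.map (algebraMap R E)).range.subgroupOf (formUnitaryGroup J),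
      ∃ m : ι → ℤ, (∀ i, m (σ i) = - m i) ∧
        (g : GL ι E) = k₁ * T5CartanUniformiser.diagonalUnit (fun i => ϖ ^ m i) * k₂)
    (k : Type*) [Field k]
    (T S : T5HeckePermutationModule.heckeAlgebra k
      ((Matrix.GeneralLinearGroup.map (algebraMap R E)).range.subgroupOf (formUnitaryGroup J))) :
    T * S = S * T :=
  T5CartanWeylInverse.heckeAlgebra_mul_comm_of_weyl k
    (T5HeckeFiniteOrbitPullback.finite_orbit_subgroupOf_GL (formUnitaryGroup J))
    (cartan_torusSet J σ ϖ hcartan) (weylElement_mem_subgroupOf J σ hJ)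
    (weylElement_mul_mul_inv J σ hJ ϖ) T S

/-- MULTIPLICITY ONE OF THE SPHERICAL LINE for `U(J)` at an inert place, modulo `hcartan`: for `k`
algebraically closed of characteristic `0` and an irreducible `K_U`-finite representation `ρ` with
`ρ^{K_U} ≠ 0` finite-dimensional, `dim ρ^{K_U} = 1`. -/
theorem finrank_invariants_eq_one_of_cartan (J : Matrix ι ι E) (σ : Equiv.Perm ι)
    (hJ : ∀ i j, J (σ i) (σ j) = J i j) (ϖ : Eˣ)
    (hcartan : ∀ g : formUnitaryGroup J,
      ∃ k₁ ∈ (Matrix.GeneralLinearGroup.map (algebraMap R E)).range.subgroupOf (formUnitaryGroup J),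
      ∃ k₂ ∈ (Matrix.GeneralLinearGroup.map (algebraMap R E)).range.subgroupOf (formUnitaryGroup J),
      ∃ m : ι → ℤ, (∀ i, m (σ i) = - m i) ∧
        (g : GL ι E) = k₁ * T5CartanUniformiser.diagonalUnit (fun i => ϖ ^ m i) * k₂)
    {k : Type*} [Field k] [CharZero k] [IsAlgClosed k] {V : Type*} [AddCommGroup V] [Module k V]
    (ρ : Representation k (formUnitaryGroup J) V) [ρ.IsIrreducible]
    (hKF : T5LevelIdempotent.KFinite ρ
      ((Matrix.GeneralLinearGroup.map (algebraMap R E)).range.subgroupOf (formUnitaryGroup J)))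
    [FiniteDimensional k (LevelPositivity.invariants ρ
      ((Matrix.GeneralLinearGroup.map (algebraMap R E)).range.subgroupOf (formUnitaryGroup J)))]
    (hne : LevelPositivity.invariants ρ
      ((Matrix.GeneralLinearGroup.map (algebraMap R E)).range.subgroupOf (formUnitaryGroup J)) ≠ ⊥) :
    Module.finrank k (LevelPositivity.invariants ρ
      ((Matrix.GeneralLinearGroup.map (algebraMap R E)).range.subgroupOf (formUnitaryGroup J))) = 1 :=
  T5CartanWeylInverse.finrank_invariants_eq_one_of_cartan ρ hKF
    (T5HeckeFiniteOrbitPullback.finite_orbit_subgroupOf_GL (formUnitaryGroup J)) hne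
    (cartan_torusSet J σ ϖ hcartan)
    (T5CartanWeylInverse.exists_inv_eq_mul_mul_of_weyl (weylElement_mem_subgroupOf J σ hJ)
      (weylElement_mul_mul_inv J σ hJ ϖ))

/-- THE HECKE OPERATORS OF `U(J)` ARE SELF-ADJOINT for every `U(J)`-invariant hermitian form on a
representation, modulo `hcartan`: `B(T_g v, w) = B(v, T_g w)` on `ρ^{K_U}`. -/
theorem apply_heckeSMul_doubleCosetOp_self_of_cartan (J : Matrix ι ι E) (σ : Equiv.Perm ι)
    (hJ : ∀ i j, J (σ i) (σ j) = J i j) (ϖ : Eˣ)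
    (hcartan : ∀ g : formUnitaryGroup J,
      ∃ k₁ ∈ (Matrix.GeneralLinearGroup.map (algebraMap R E)).range.subgroupOf (formUnitaryGroup J),
      ∃ k₂ ∈ (Matrix.GeneralLinearGroup.map (algebraMap R E)).range.subgroupOf (formUnitaryGroup J),
      ∃ m : ι → ℤ, (∀ i, m (σ i) = - m i) ∧
        (g : GL ι E) = k₁ * T5CartanUniformiser.diagonalUnit (fun i => ϖ ^ m i) * k₂)
    {k : Type*} [Field k] [StarRing k] {V : Type*} [AddCommGroup V] [Module k V]
    {ρ : Representation k (formUnitaryGroup J) V} {B : V →ₗ⋆[k] V →ₗ[k] k}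
    (hB : T5HeckeAdjointHermitian.IsInvariantSesq ρ B) (hH : T5HeckeAdjointHermitian.IsHermitian B)
    (g : formUnitaryGroup J)
    (v w : LevelPositivity.invariants ρ
      ((Matrix.GeneralLinearGroup.map (algebraMap R E)).range.subgroupOf (formUnitaryGroup J))) :
    B (T5HeckePermutationModule.heckeSMul ρ (T5HeckeDoubleCoset.doubleCosetOp k
        ((Matrix.GeneralLinearGroup.map (algebraMap R E)).range.subgroupOf (formUnitaryGroup J)) g) v) w =
      B v (T5HeckePermutationModule.heckeSMul ρ (T5HeckeDoubleCoset.doubleCosetOp k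
        ((Matrix.GeneralLinearGroup.map (algebraMap R E)).range.subgroupOf (formUnitaryGroup J)) g) w) :=
  T5CartanWeylInverse.apply_heckeSMul_doubleCosetOp_self_of_cartan
    (T5HeckeFiniteOrbitPullback.finite_orbit_subgroupOf_GL (formUnitaryGroup J)) hB hH
    (cartan_torusSet J σ ϖ hcartan)
    (T5CartanWeylInverse.exists_inv_eq_mul_mul_of_weyl (weylElement_mem_subgroupOf J σ hJ)
      (weylElement_mul_mul_inv J σ hJ ϖ)) g v w

/-- The printed shape for `ι = Fin n`, `σ = Fin.rev`: `J` persymmetric (`J (rev i) (rev j) = J i j`, e.g.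
`antidiag(1, …, 1, u, 1, …, 1)`), torus `diag(ϖ^{m_1}, …, ϖ^{m_r}, 1, ϖ^{-m_r}, …, ϖ^{-m_1})` (`m ∘ rev = −m`):
`H(U(J), K_U)` is commutative modulo the Cartan decomposition. -/
theorem heckeAlgebra_mul_comm_of_cartan_rev {n : ℕ} (J : Matrix (Fin n) (Fin n) E)
    (hJ : ∀ i j, J (Fin.rev i) (Fin.rev j) = J i j) (ϖ : Eˣ)
    (hcartan : ∀ g : formUnitaryGroup J,
      ∃ k₁ ∈ (Matrix.GeneralLinearGroup.map (algebraMap R E)).range.subgroupOf (formUnitaryGroup J),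
      ∃ k₂ ∈ (Matrix.GeneralLinearGroup.map (algebraMap R E)).range.subgroupOf (formUnitaryGroup J),
      ∃ m : Fin n → ℤ, (∀ i, m (Fin.rev i) = - m i) ∧
        (g : GL (Fin n) E) = k₁ * T5CartanUniformiser.diagonalUnit (fun i => ϖ ^ m i) * k₂)
    (k : Type*) [Field k]
    (T S : T5HeckePermutationModule.heckeAlgebra k
      ((Matrix.GeneralLinearGroup.map (algebraMap R E)).range.subgroupOf (formUnitaryGroup J))) :
    T * S = S * T :=
  heckeAlgebra_mul_comm_of_cartan J Fin.revPerm (by simpa using hJ) ϖ (by simpa using hcartan) k T S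

end Local

end Summit.Ventures.HodgeRepro2.T5UnitaryGroupForm
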